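import Summits.AtomisticToContinuum.FouriersLaw.Theorems.BondHeatUncertaintySubdiffusiveBondHeatAnharmonicityWindowLadder
import Summits.AtomisticToContinuum.FouriersLaw.Theorems.BondHeatUncertaintySubdiffusiveBondHeatCovariantCorrectorCeiling

/-!
# `KineticCorrectorBudget` ladder — the free bi-graded strip `s ≤ 1` UNCONDITIONALLY, at `N₀ = 2` (decomp-a2c lens-1 g56, critic row 716)

`BigradedCorrectorBudget s α` (lens-1 g54, `…AnharmonicityWindowLadder`) quantifies `∃ N₀, ∀ N ≥ N₀`, so the landed `N ≥ 2` covariant ceiling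
`covariantCorrectorCeiling_two` (hand-2 g19) enters VERBATIM with `N₀ := 2`: the seam `bigradedCorrectorBudget_one_of_covariantCeiling` with its
hypothesis `CovariantCorrectorCeiling` (stated for every `N`, incl. the junk lengths `N = 0, 1`) replaced by the tree theorem.  Result:
`KCB^{(s)}_{[α]}` for every `s ≤ 1` and every window exponent `α`, no hypothesis.  No definitions, no `sorry`, standard axioms.
`--supports stmt-AtomisticToContinuum-9120`.
-/

noncomputable section

namespace Summit.AtomisticToContinuum.FouriersLaw.Theorems.SubdiffusiveBondHeat.CorrectorBudget.Ladder

/-- **`KCB^{(1)}_{[α]}` unconditionally** (`θ = 1`, `C = 2/γ + max b 0`, `N₀ = 2`), from `covariantCorrectorCeiling_two`. [this file] -/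
theorem bigradedCorrectorBudget_one_of_covariantCeiling_two (α : ℝ) : BigradedCorrectorBudget 1 α := by
  intro ω₂ lam β γ hω hl hβ hγ
  obtain ⟨b, hb⟩ := covariantCorrectorCeiling_two ω₂ lam β γ hω hl hβ hγ
  refine ⟨1, one_pos, 2 / γ + max b 0, 2, fun N hN T hT _ τ hτ hτs => ?_⟩
  have h := hb T hT N hN τ hτ
  have hc : 0 ≤ 2 * T ^ 2 / γ := by positivity
  have hN1 : (1 : ℝ) ≤ (N : ℝ) := by exact_mod_cast (show 1 ≤ N by omega)
  have hτN : τ ≤ (N : ℝ) := by simpa [Real.rpow_one] using hτs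
  have hT2 : 0 ≤ T ^ 2 := sq_nonneg T
  have h1 : 2 * T ^ 2 / γ * τ ≤ 2 * T ^ 2 / γ * (N : ℝ) := mul_le_mul_of_nonneg_left hτN hc
  have h2 : b * T ^ 2 ≤ max b 0 * T ^ 2 * (N : ℝ) :=
    (mul_le_mul_of_nonneg_right (le_max_left b 0) hT2).trans
      (le_mul_of_one_le_right (mul_nonneg (le_max_right b 0) hT2) hN1)
  calc correctorNormSq ω₂ lam β γ T N τ ≤ 2 * T ^ 2 / γ * τ + b * T ^ 2 := h
    _ ≤ 2 * T ^ 2 / γ * (N : ℝ) + max b 0 * T ^ 2 * (N : ℝ) := add_le_add h1 h2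
    _ = (2 / γ + max b 0) * (N : ℝ) * T ^ 2 := by ring

/-- **The free strip, unconditionally: `s ≤ 1 → KCB^{(s)}_{[α]}`** for every `α`. [this file] -/
theorem bigradedCorrectorBudget_of_covariantCeiling_two_of_le_one {s : ℝ} (hs : s ≤ 1) (α : ℝ) :
    BigradedCorrectorBudget s α :=
  bigradedCorrectorBudget_mono hs le_rfl (bigradedCorrectorBudget_one_of_covariantCeiling_two α)

end Summit.AtomisticToContinuum.FouriersLaw.Theorems.SubdiffusiveBondHeat.CorrectorBudget.Ladder

end
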